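import Summits.Ventures.WeilGRH.KeySectionToTest
import Literature.NumberTheory.LFunctions.WeilWindowForm
import Literature.NumberTheory.LFunctions.WeilWindowSuzukiProofs
import HarnessLib

/-!
# GRH arm (rh-explicit, venture WeilGRH): the section → test-function transfer for `ζ` itself — the window form
  with its POLE term; upper bounds for the ground energy `ε(t)` and refutations of `WeilPositivityOn` from sections

Cell `rh-explicit`, WEIL TRACK (lit/typing seat weil-grh-5; the `q = 1` companion of `KeySectionToTest.lean`, for the
lead track's `ζ` window form `weilWindowForm a u = P(u) + 𝓔_a(u) − M_a‖u‖₂²` of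
`Literature/…/WeilWindowForm.lean`, the object weil-2/weil-3's format-C certificates evaluate on trigonometric
sections).  The Markov part is the key form of the TRIVIAL character (`weilWindowForm_eq_pole_add_keyMarkovForm`:
`weilWindowForm a w = weilPoleForm w + keyMarkovForm a₁ (log 1) χ₁ a w`, `χ₁` the character mod `1`), so the
mollifier machinery of `KeyWindowSmoothing.lean` applies; the pole form `P(w) = 2|∫w cosh(x/2)|² − 2|∫w sinh(x/2)|²`
is a pair of pairings against continuous weights and converges along mollifiers (`tendsto_weilPoleForm_mollify`).

* ★ `exists_isWeilTest_re_weilQuadratic_lt`: `u` a window function on `[-b, b]`, `0 ≤ b < t`,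
  `weilWindowForm t u < B‖u‖₂²` ⇒ for every `ε > 0` a TEST function `g` on `[-t, t]` with `Re Q(g) < B‖g‖₂²` and
  `|‖g‖₂² − ‖u‖₂²| < ε`;
* `weilWindowForm_window_eq_of_isWindowFunction`: the window parameter `c ≥ b` is immaterial for `u` on `[-b, b]`;
* ★ `weilGroundEnergy_le_of_isWindowFunction`: **every section Rayleigh quotient on a smaller window bounds the
  ground energy from ABOVE** — `u ≠ 0` on `[-b, b]`, `b < t`, `weilWindowForm b u ≤ B‖u‖₂² ⇒ ε(t) ≤ B` (the converse
  companion of weil-3's `le_weilGroundEnergy_of_trig_margin`: certified two-sided enclosures of `ε(t)` from finite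
  sections);
* `not_weilPositivityOn_of_isWindowFunction`: a section with negative window form on `[-b, b]` refutes
  `WeilPositivityOn t` for every `t > b`.

Everything is proved; no definitions; no named facts; RH-free.  Sources: mollification [folklore]; the form:
Bombieri 2000 Thm 2 p. 193, §4 [Bombieri2000Weil]; Suzuki, Cor. 1.2 (ε as infimum of the Rayleigh quotient)
[Suzuki2026]; Yoshida 1992 §2 [Yoshida1992].
-/

set_option autoImplicit false

noncomputable section

open Complex Filter Set MeasureTheory ContinuousLinearMap Metric
open scoped Real Topology ComplexConjugate Convolution ArithmeticFunction.vonMangoldt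

namespace Summit.Ventures.WeilGRH

open Literature.NumberTheory.LFunctions
open Summit.RiemannHypothesis.RiemannHypothesis.Theorems.WeilFormatC

variable {b : ℝ} {u : ℝ → ℂ}

/-! ## The `ζ` window form is the pole form plus the key form of the trivial character -/

/-- `weilWindowForm a w = P(w) + keyMarkovForm a_{χ₁} (log 1) χ₁ a w` for the character `χ₁` mod `1` (any `w`).
[cite: Bombieri2000Weil, Thm 2 (p. 193)] -/
theorem weilWindowForm_eq_pole_add_keyMarkovForm (a : ℝ) (w : ℝ → ℂ) :
    weilWindowForm a w = weilPoleForm w +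
      keyMarkovForm (charParity (1 : DirichletCharacter ℂ 1)) (Real.log (1 : ℕ))
        (fun n ↦ (1 : DirichletCharacter ℂ 1) (n : ZMod 1)) a w := by
  rw [weilWindowForm, keyMarkovForm, ← weilDirichletEnergyChar_eq_key, ← weilMarkovConstantChar_eq_key,
    weilDirichletEnergyChar_modOne, weilMarkovConstantChar_modOne]
  ring

/-- The window parameter beyond the support is immaterial: `u` on `[-b, b]`, `b ≤ c` ⇒
`weilWindowForm c u = weilWindowForm b u`. [folklore] -/
theorem weilWindowForm_window_eq_of_isWindowFunction (hu : IsWindowFunction b u) {c : ℝ} (hbc : b ≤ c) :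
    weilWindowForm c u = weilWindowForm b u := by
  rw [weilWindowForm_eq_pole_add_keyMarkovForm, weilWindowForm_eq_pole_add_keyMarkovForm,
    keyMarkovForm_window_eq_of_isWindowFunction hu hbc]

/-! ## The pole form along mollifiers -/

/-- Pairings against a continuous weight converge along mollifiers: `∫ (φ_i⋆u) c → ∫ u c` (bumps with `rOut → 0`,
`rOut ≤ 2 rIn`, `rOut ≤ 1`; dominated convergence on `[-b − 1, b + 1]`). [folklore] -/
theorem tendsto_integral_mul_mollify {φ : ℕ → ContDiffBump (0 : ℝ)} (hu : IsWindowFunction b u)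
    (hφ : Tendsto (fun i ↦ (φ i).rOut) atTop (𝓝 0)) (h'φ : ∀ᶠ i in atTop, (φ i).rOut ≤ 2 * (φ i).rIn)
    (h1 : ∀ i, (φ i).rOut ≤ 1) {c : ℝ → ℂ} (hc : Continuous c) :
    Tendsto (fun i ↦ ∫ x, ((φ i).normed volume ⋆[lsmul ℝ ℝ, volume] u) x * c x) atTop (𝓝 (∫ x, u x * c x)) := by
  obtain ⟨S, hS0, hS⟩ := hu.bounded'
  have hcont : ∀ i, Continuous ((φ i).normed volume ⋆[lsmul ℝ ℝ, volume] u) := fun i ↦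
    (isWeilTest_mollify (φ i) hu).1.continuous
  refine tendsto_integral_of_dominated_convergence (fun x ↦ (Icc (-b - 1) (b + 1)).indicator (fun x ↦ S * ‖c x‖) x)
    (fun i ↦ ((hcont i).mul hc).aestronglyMeasurable) ?_ ?_ ?_
  · exact (integrable_indicator_iff measurableSet_Icc).2
      ((continuous_const.mul hc.norm).continuousOn.integrableOn_Icc)
  · intro i
    refine Eventually.of_forall fun x ↦ ?_
    by_cases hx : x ∈ Icc (-b - 1) (b + 1)
    · rw [indicator_of_mem hx, norm_mul]
      exact mul_le_mul_of_nonneg_right (norm_mollify_le (φ i) hu hS _) (norm_nonneg _)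
    · have hx' : x ∉ Icc (-b - (φ i).rOut) (b + (φ i).rOut) := by
        intro h
        apply hx
        rw [mem_Icc] at h ⊢
        constructor <;> linarith [h.1, h.2, h1 i]
      rw [mollify_eq_zero (φ i) hu hx', zero_mul, norm_zero, indicator_of_notMem hx]
  · filter_upwards [ae_tendsto_mollify hu hφ h'φ] with x hx
    exact hx.mul tendsto_const_nhds

/-- **The pole form converges along mollifiers**: `P(φ_i ⋆ u) → P(u)`. [folklore] -/
theorem tendsto_weilPoleForm_mollify {φ : ℕ → ContDiffBump (0 : ℝ)} (hu : IsWindowFunction b u)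
    (hφ : Tendsto (fun i ↦ (φ i).rOut) atTop (𝓝 0)) (h'φ : ∀ᶠ i in atTop, (φ i).rOut ≤ 2 * (φ i).rIn)
    (h1 : ∀ i, (φ i).rOut ≤ 1) :
    Tendsto (fun i ↦ weilPoleForm ((φ i).normed volume ⋆[lsmul ℝ ℝ, volume] u)) atTop (𝓝 (weilPoleForm u)) := by
  have hcosh : Continuous fun x : ℝ ↦ ((Real.cosh (x / 2) : ℝ) : ℂ) := by fun_prop
  have hsinh : Continuous fun x : ℝ ↦ ((Real.sinh (x / 2) : ℝ) : ℂ) := by fun_prop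
  have h1' := ((continuous_norm.tendsto _).comp (tendsto_integral_mul_mollify hu hφ h'φ h1 hcosh)).pow 2
  have h2' := ((continuous_norm.tendsto _).comp (tendsto_integral_mul_mollify hu hφ h'φ h1 hsinh)).pow 2
  unfold weilPoleForm
  exact (h1'.const_mul 2).sub (h2'.const_mul 2)

/-! ## The transfer for `ζ` -/

/-- **FROM A WINDOW FUNCTION TO A TEST FUNCTION, `ζ` version.**  `u` a window function on `[-b, b]`, `0 ≤ b < t`,
with `weilWindowForm t u < B‖u‖₂²`.  Then for every `ε > 0` some Weil test function `g` supported in `[-t, t]` has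
`Re Q(g) < B‖g‖₂²` and `|‖g‖₂² − ‖u‖₂²| < ε`. [folklore] -/
theorem exists_isWeilTest_re_weilQuadratic_lt (hb : 0 ≤ b) (hu : IsWindowFunction b u) {t : ℝ} (hbt : b < t)
    {B : ℝ} (hB : weilWindowForm t u < B * ∫ x, ‖u x‖ ^ 2) {ε : ℝ} (hε : 0 < ε) :
    ∃ g : ℝ → ℂ, IsWeilTest g ∧ tsupport g ⊆ Icc (-t) t ∧ (weilQuadratic g).re < B * ∫ x, ‖g x‖ ^ 2 ∧
      |(∫ x, ‖g x‖ ^ 2) - ∫ x, ‖u x‖ ^ 2| < ε := by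
  -- bump sequence
  set r₀ : ℝ := min 1 (t - b) with hr₀
  have hr₀0 : 0 < r₀ := lt_min one_pos (by linarith)
  set r : ℕ → ℝ := fun i ↦ r₀ * (1 / ((i : ℝ) + 1)) with hr
  have hrpos : ∀ i, 0 < r i := fun i ↦ by positivity
  have hrle : ∀ i, r i ≤ r₀ := fun i ↦ by
    rw [hr]
    have h1 : 1 / ((i : ℝ) + 1) ≤ 1 := by
      rw [div_le_one (by positivity)]
      linarith [Nat.cast_nonneg (α := ℝ) i]
    nlinarith
  let φ : ℕ → ContDiffBump (0 : ℝ) := fun i ↦ ⟨r i / 2, r i, half_pos (hrpos i), half_lt_self (hrpos i)⟩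
  have hφ : Tendsto (fun i ↦ (φ i).rOut) atTop (𝓝 0) := by
    have h : Tendsto r atTop (𝓝 0) := by
      rw [hr]
      simpa using (tendsto_one_div_add_atTop_nhds_zero_nat (𝕜 := ℝ)).const_mul r₀
    exact h
  have h'φ : ∀ᶠ i in atTop, (φ i).rOut ≤ 2 * (φ i).rIn := Eventually.of_forall fun i ↦ by
    show r i ≤ 2 * (r i / 2)
    linarith
  have h1 : ∀ i, (φ i).rOut ≤ 1 := fun i ↦ (hrle i).trans (min_le_left _ _)
  -- abbreviations
  set a₁ : ℕ := charParity (1 : DirichletCharacter ℂ 1) with ha₁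
  set L₁ : ℝ := Real.log (1 : ℕ) with hL₁
  set v₁ : ℕ → ℂ := fun n ↦ (1 : DirichletCharacter ℂ 1) (n : ZMod 1) with hv₁
  set Nu : ℝ := ∫ x, ‖u x‖ ^ 2 with hNu
  -- the margin and the tolerance
  set gap : ℝ := B * Nu - weilWindowForm t u with hgap
  have hgap0 : 0 < gap := by rw [hgap]; linarith
  set δ : ℝ := min (gap / (3 * (1 + |B|))) ε with hδ
  have hδ0 : 0 < δ := lt_min (by positivity) hε
  have hδ1 : δ ≤ gap / (3 * (1 + |B|)) := min_le_left _ _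
  have hδ2 : δ ≤ ε := min_le_right _ _
  -- eventually: key part and norm, pole part
  have hK := eventually_keyMarkovForm_mollify_le hb hu hφ h'φ h1 a₁ L₁ v₁ t hδ0
  have hP : ∀ᶠ i in atTop, dist (weilPoleForm ((φ i).normed volume ⋆[lsmul ℝ ℝ, volume] u)) (weilPoleForm u) < δ :=
    Metric.tendsto_nhds.1 (tendsto_weilPoleForm_mollify hu hφ h'φ h1) δ hδ0
  obtain ⟨i, ⟨hKi, hNi⟩, hPi⟩ := (hK.and hP).exists
  set gi : ℝ → ℂ := (φ i).normed volume ⋆[lsmul ℝ ℝ, volume] u with hgi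
  have hsupp : tsupport gi ⊆ Icc (-t) t := by
    refine (tsupport_mollify_subset (φ i) hu).trans (Icc_subset_Icc ?_ ?_)
    · have : (φ i).rOut ≤ t - b := (hrle i).trans (min_le_right _ _)
      linarith
    · have : (φ i).rOut ≤ t - b := (hrle i).trans (min_le_right _ _)
      linarith
  refine ⟨gi, isWeilTest_mollify (φ i) hu, hsupp, ?_, hNi.trans_le hδ2⟩
  set Ni : ℝ := ∫ x, ‖gi x‖ ^ 2 with hNidef
  rw [Real.dist_eq] at hPi
  have hWu : weilWindowForm t u = weilPoleForm u + keyMarkovForm a₁ L₁ v₁ t u :=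
    weilWindowForm_eq_pole_add_keyMarkovForm t u
  have hWg : (weilQuadratic gi).re = weilPoleForm gi + keyMarkovForm a₁ L₁ v₁ t gi := by
    rw [← weilWindowForm_eq_re_weilQuadratic (isWeilTest_mollify (φ i) hu) hsupp,
      weilWindowForm_eq_pole_add_keyMarkovForm]
  have hBN : B * Nu - B * Ni ≤ |B| * δ := by
    calc B * Nu - B * Ni = B * (Nu - Ni) := by ring
      _ ≤ |B * (Nu - Ni)| := le_abs_self _
      _ = |B| * |Ni - Nu| := by rw [abs_mul, abs_sub_comm]
      _ ≤ |B| * δ := mul_le_mul_of_nonneg_left hNi.le (abs_nonneg _)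
  have hPle : weilPoleForm gi ≤ weilPoleForm u + δ := by linarith [(abs_lt.1 hPi).2]
  have hδ3 : δ * (3 * (1 + |B|)) ≤ gap := by
    have := mul_le_mul_of_nonneg_right hδ1 (by positivity : (0 : ℝ) ≤ 3 * (1 + |B|))
    rwa [div_mul_cancel₀ _ (by positivity : (3 * (1 + |B|) : ℝ) ≠ 0)] at this
  rw [hWg]
  rw [hWu] at hgap
  nlinarith [abs_nonneg B]

/-! ## Consequences: the ground energy from above, and negative sections -/

/-- **EVERY SECTION RAYLEIGH QUOTIENT BOUNDS THE GROUND ENERGY FROM ABOVE.**  `u` a window function on `[-b, b]`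
with `‖u‖₂ > 0`, `0 ≤ b < t`, `weilWindowForm b u ≤ B‖u‖₂²` ⇒ `ε(t) = weilGroundEnergy t ≤ B` (smooth a near-extremal
section and use `weilGroundEnergy_le_div`). [cite: Suzuki2026, Cor. 1.2; Bombieri2000Weil, §4] -/
theorem weilGroundEnergy_le_of_isWindowFunction (hb : 0 ≤ b) (hu : IsWindowFunction b u) {t : ℝ} (hbt : b < t)
    (hu0 : 0 < ∫ x, ‖u x‖ ^ 2) {B : ℝ} (hB : weilWindowForm b u ≤ B * ∫ x, ‖u x‖ ^ 2) :
    weilGroundEnergy t ≤ B := by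
  refine le_of_forall_gt_imp_ge_of_dense fun B' hB' ↦ ?_
  have hlt : weilWindowForm t u < B' * ∫ x, ‖u x‖ ^ 2 := by
    rw [weilWindowForm_window_eq_of_isWindowFunction hu hbt.le]
    exact hB.trans_lt (mul_lt_mul_of_pos_right hB' hu0)
  obtain ⟨g, hg, hsupp, hQ, hN⟩ := exists_isWeilTest_re_weilQuadratic_lt hb hu hbt hlt (half_pos hu0)
  have hNg : 0 < ∫ x, ‖g x‖ ^ 2 := by
    have := (abs_lt.1 hN).1
    linarith
  have h := weilGroundEnergy_le_div hg hsupp hNg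
  have h' : (weilQuadratic g).re / ∫ x, ‖g x‖ ^ 2 < B' := (div_lt_iff₀ hNg).2 hQ
  exact (h.trans h'.le)

/-- **A negative section refutes `ζ`-positivity on every larger window**: `u` a window function on `[-b, b]`,
`0 ≤ b < t`, `weilWindowForm b u < 0 ⇒ ¬ WeilPositivityOn t`. [folklore] -/
theorem not_weilPositivityOn_of_isWindowFunction (hb : 0 ≤ b) (hu : IsWindowFunction b u) {t : ℝ} (hbt : b < t)
    (hneg : weilWindowForm b u < 0) : ¬ WeilPositivityOn t := by
  have hlt : weilWindowForm t u < 0 * ∫ x, ‖u x‖ ^ 2 := by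
    rw [zero_mul, weilWindowForm_window_eq_of_isWindowFunction hu hbt.le]
    exact hneg
  obtain ⟨g, hg, hsupp, hQ, -⟩ := exists_isWeilTest_re_weilQuadratic_lt hb hu hbt hlt one_pos
  rw [zero_mul] at hQ
  intro hpos
  have h := hpos g hg hsupp
  linarith

end Summit.Ventures.WeilGRH

end
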